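import Summits.BirchSwinnertonDyer.Rank1Residual.O5.O5FlatKummerNormalForm
import Mathlib.NumberTheory.Padics.Hensel
import HarnessLib

/-!
# O5 — T30.2/T30.3 + A1, the UNIT HALF of `FlexNFCaseNKummerLawThree` PROVED: `(cellN b A₃).k = 1 → NFKummerHasUnit b A₃ 0`
# on EVERY Case-N flex normal form `y² + 3b·xy + A₃y = x³` (`A₃ ≡ 1 (mod 3)`, `b³ ≠ A₃`)
# (cell `b2b-bsdres`, team n1011, ROW T-FLEX-KOD extension 4; seat `b2b-bsdres-n1011-p18` GEN 14 under the idle rule;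
#  theorems only; nothing of the typer's file is edited)

HONEST FRAMING (cell `b2b-bsdres`, run/shared/lean/b2b/bsd-rank1-residual/, verbatim in every file): the
goal of the cell is to DELETE the COMBINATION-SHAPED residual classes of the Birch–Swinnerton-Dyer formula
for ALL analytic-rank `≤ 1` elliptic curves over `ℚ` — "full BSD formula for every rank `≤ 1` curve in
class `C`" assembled STRICTLY from published theorems — so that the rank-`≤ 1` remainder becomes exactly
the CONSTRUCTION-SHAPED classes, which are TYPED (missing-input `Prop`s), NOT attempted. This is not
"finishing BSD". Lane CLASS-CLOSURE / O5 (O5 OPEN): research route; census output (P-K19) is EVIDENCE,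
never a Literature fact; nothing is booked; no mark of `RESIDUAL-MAP.md` moves. This file: THEOREMS ONLY
(no definition, no named fact, no `@[conjecture]` node, no `sorry`; net named-fact debt `0`).  It proves the
SECOND of the three conjuncts of the node T30.2/T30.3 + A1 `FlexNFCaseNKummerLawThree` for every `(b, A₃)`; the
first (`NFKummerFlat`) is the typer's `nfKummerFlat_zero`; the third (`k = 0 → NFKummerTrivial`, "`E = 3E + E⁰`")
is NOT claimed.  Closes NO pair and moves NO mark.

## What is proved

* `nfKummerHasUnit_zero_of_cusp` (o5-r1's amendment A1): for `b ≡ 1 (mod 3)`, `A₃ ≡ 1 (mod 9)` and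
  `m := (3b − 2 − A₃)/9 ≡ 1 (mod 3)`, the curve has the `ℚ₃`-point `Q = (−1, 1 + 3η)` with `η² − 3mη − m = 0`,
  `η ≡ 1 (mod 3)` (Hensel at `η₀ = 1`: `G(1) = 1 − 4m ∈ 3ℤ₃`, `G′(1) = 2 − 3m` a unit), so `y(Q) = 4 + 9κ` is a flat
  NON-cube (`4² ≢ 1 (mod 9)`): `NFKummerHasUnit b A₃ 0`.
* `nfKummerHasUnit_zero_of_cellN_k_eq_one`: `A₃ ≡ 1 (mod 3)`, `b³ ≠ A₃`, `(cellN b A₃).k = 1 ⟹ NFKummerHasUnit b A₃ 0`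
  — by the typer's `nfKummerHasUnit_zero_of_emod_nine` when `A₃ ≢ 1 (mod 9)`, else `cellN` forces `b ≡ 1 (mod 3)`,
  `ord3 64 (b³ − A₃) = 2` and `m ≡ 1 (mod 3)` and the cusp point applies (`w` is not even needed: `m ≡ 1` alone
  gives the point).
* `flexNFCaseNKummerLawThree_unit_half`: the node's second conjunct, universally.
[cite: CohenPazuki2009ThreeDescent, Def. 1.3 and Prop. 2.2 (arXiv:0903.4963 pp. 4–5)] [cite: SilvermanATAEC1994, IV.9.4]
-/

noncomputable section

open Polynomial

namespace Summit.BirchSwinnertonDyer.Rank1Residual.O5.FlexNormalForm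

/-! ## §1 The cusp point `Q = (−1, 4 + 9κ)` (amendment A1) -/

/-- `‖n‖ = 1` in `ℤ₃` for an integer `n` prime to `3`. [folklore] -/
private theorem norm_intCast_eq_one' {n : ℤ} (hn : ¬ (3 : ℤ) ∣ n) : ‖(n : ℤ_[3])‖ = 1 :=
  le_antisymm (PadicInt.norm_le_one _)
    (not_lt.1 fun h ↦ hn (by exact_mod_cast (PadicInt.norm_int_lt_one_iff_dvd n).1 h))

/-- `‖n‖ < 1` in `ℤ₃` for an integer `n` divisible by `3`. [folklore] -/
private theorem norm_intCast_lt_one' {n : ℤ} (hn : (3 : ℤ) ∣ n) : ‖(n : ℤ_[3])‖ < 1 :=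
  (PadicInt.norm_int_lt_one_iff_dvd n).2 (by exact_mod_cast hn)

/-- **Hensel for the cusp point.** For an integer `m ≡ 1 (mod 3)` the polynomial `η² − 3mη − m` has a root
`η ∈ ℤ₃` with `‖η − 1‖ < 1`. [folklore] -/
theorem exists_root_cusp_quadratic (m : ℤ) (hm : m % 3 = 1) :
    ∃ η : ℤ_[3], η ^ 2 - 3 * (m : ℤ_[3]) * η - (m : ℤ_[3]) = 0 ∧ ‖η - 1‖ < 1 := by
  let G : ℤ_[3][X] := X ^ 2 - C (3 * (m : ℤ_[3])) * X - C (m : ℤ_[3])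
  have hG : ∀ t : ℤ_[3], aeval t G = t ^ 2 - 3 * (m : ℤ_[3]) * t - (m : ℤ_[3]) := fun t ↦ by
    simp [G]
  have hG' : ∀ t : ℤ_[3], aeval t (derivative G) = 2 * t - 3 * (m : ℤ_[3]) := fun t ↦ by
    simp [G, derivative_mul]
    try ring
    try norm_num
    try simp
  have hn1 : ‖aeval (1 : ℤ_[3]) (derivative G)‖ = 1 := by
    rw [hG', show (2 : ℤ_[3]) * 1 - 3 * (m : ℤ_[3]) = ((2 - 3 * m : ℤ) : ℤ_[3]) by push_cast; ring]
    exact norm_intCast_eq_one' (by omega)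
  have hn0 : ‖aeval (1 : ℤ_[3]) G‖ < 1 := by
    rw [hG, show (1 : ℤ_[3]) ^ 2 - 3 * (m : ℤ_[3]) * 1 - (m : ℤ_[3]) = ((1 - 4 * m : ℤ) : ℤ_[3]) by push_cast; ring]
    exact norm_intCast_lt_one' (by omega)
  have hnorm : ‖aeval (1 : ℤ_[3]) G‖ < ‖aeval (1 : ℤ_[3]) (derivative G)‖ ^ 2 := by
    rw [hn1, one_pow]; exact hn0
  obtain ⟨η, hη, hη1, -, -⟩ := hensels_lemma hnorm
  exact ⟨η, by rw [← hG]; exact hη, by rw [← hn1]; exact hη1⟩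

/-- `4 + 9κ` (`κ ∈ ℤ₃`) is a `3`-adic unit which is not a cube in `ℚ₃`. [folklore] -/
theorem four_add_nine_mul_not_cube (κ : ℤ_[3]) :
    ‖((4 + 9 * κ : ℤ_[3]) : ℚ_[3])‖ = 1 ∧ ¬ ∃ w : ℚ_[3], ((4 + 9 * κ : ℤ_[3]) : ℚ_[3]) = w ^ 3 := by
  have h4 : ‖(4 : ℤ_[3])‖ = 1 := by exact_mod_cast norm_intCast_eq_one' (n := 4) (by decide)
  have h9 : ‖(9 : ℤ_[3]) * κ‖ < 1 := by
    rw [norm_mul]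
    have h9' : ‖(9 : ℤ_[3])‖ < 1 := by exact_mod_cast norm_intCast_lt_one' (n := 9) (by decide)
    calc ‖(9 : ℤ_[3])‖ * ‖κ‖ ≤ ‖(9 : ℤ_[3])‖ * 1 := by gcongr; exact PadicInt.norm_le_one _
      _ < 1 := by rw [mul_one]; exact h9'
  have hA : ‖(4 + 9 * κ : ℤ_[3])‖ = 1 := by
    rw [PadicInt.norm_add_eq_max_of_ne (by rw [h4]; exact ne_of_gt h9), h4, max_eq_left h9.le]
  have hres : (PadicInt.toZModPow 2 (4 + 9 * κ : ℤ_[3])) ^ 2 ≠ 1 := by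
    have c9 : (9 : ZMod (3 ^ 2)) = 0 := by decide
    rw [map_add, map_mul, map_ofNat, map_ofNat, c9, zero_mul, add_zero]
    decide
  exact ⟨by rw [← PadicInt.norm_def]; exact hA, ThreeTorsionNormalForm.not_exists_pow_three_eq_of_sq_ne_one hA hres⟩

/-- **Amendment A1 (o5-r1 GEN 13): the cusp point gives a UNIT class.**  For `b ≡ 1 (mod 3)`, `A₃ ≡ 1 (mod 9)` and
`(3b − 2 − A₃)/9 ≡ 1 (mod 3)`, the curve `y² + 3b·xy + A₃y = x³` has the `ℚ₃`-point `(−1, 1 + 3η)`, `η ≡ 1 (mod 3)`,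
whose `y = 4 + 9κ` is a flat non-cube: `NFKummerHasUnit b A₃ 0`.
[cite: CohenPazuki2009ThreeDescent, Def. 1.3 and Prop. 2.2 (arXiv:0903.4963 pp. 4–5)] -/
theorem nfKummerHasUnit_zero_of_cusp (b A₃ : ℤ) (hb : b % 3 = 1) (hA : A₃ % 9 = 1)
    (hm : ((3 * b - 2 - A₃) / 9) % 3 = 1) : NFKummerHasUnit b A₃ 0 := by
  set m : ℤ := (3 * b - 2 - A₃) / 9 with hmdef
  have h9m : 3 * b - 2 - A₃ = 9 * m := by omega
  obtain ⟨η, hη, hη1⟩ := exists_root_cusp_quadratic m hm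
  -- `η = 1 + 3κ`
  obtain ⟨κ, hκ⟩ : ∃ κ : ℤ_[3], η = 1 + 3 * κ := by
    obtain ⟨κ, hκ⟩ := (PadicInt.norm_lt_one_iff_dvd (η - 1)).1 hη1
    exact ⟨κ, by rw [← sub_eq_iff_eq_add']; exact_mod_cast hκ⟩
  have hy : (1 + 3 * η : ℤ_[3]) = 4 + 9 * κ := by rw [hκ]; ring
  obtain ⟨hn, hnc⟩ := four_add_nine_mul_not_cube κ
  rw [← hy] at hn hnc
  refine ⟨-1, ((1 + 3 * η : ℤ_[3]) : ℚ_[3]), ?_, by norm_num, ?_, hnc⟩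
  · -- the equation: `y² − 3b·y + A₃·y + 1 = 9(η² − 3mη − m) = 0`
    have hη' : ((η ^ 2 - 3 * (m : ℤ_[3]) * η - (m : ℤ_[3]) : ℤ_[3]) : ℚ_[3]) = 0 := by rw [hη]; rfl
    have h9m' : (3 * (b : ℚ_[3]) - 2 - (A₃ : ℚ_[3])) = 9 * (m : ℚ_[3]) := by exact_mod_cast h9m
    have h3c : ((3 : ℤ_[3]) : ℚ_[3]) = 3 := by exact_mod_cast PadicInt.coe_natCast (p := 3) 3
    push_cast at hη'
    try rw [h3c] at hη'
    simp only [OnNF]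
    push_cast
    try rw [h3c]
    linear_combination (9 : ℚ_[3]) * hη' - (3 * (η : ℚ_[3]) + 1) * h9m'
  · -- flat: a unit has valuation `0`
    exact ⟨0, by
      have := (ThreeTorsionNormalForm.norm_eq_one_iff.mp hn).2
      rw [this]; ring⟩

/-! ## §2 The unit half of the node, on every Case-N cell -/

/-- **`(cellN b A₃).k = 1 ⟹ NFKummerHasUnit b A₃ 0`** for `A₃ ≡ 1 (mod 3)`, `b³ ≠ A₃`: either `A₃ ≢ 1 (mod 9)`
(typer's `nfKummerHasUnit_zero_of_emod_nine`, from x11b3-p7 p308301) or `cellN` is in the `IV`, `c₃ = 3` cell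
(`b ≡ 1 (mod 3)`, `A₃ ≡ 1 (mod 9)`, `m ≡ 1 (mod 3)`) and the cusp point applies.
[cite: CohenPazuki2009ThreeDescent, Def. 1.3 and Prop. 2.2 (arXiv:0903.4963 pp. 4–5)] -/
theorem nfKummerHasUnit_zero_of_cellN_k_eq_one (b A₃ : ℤ) (hA : A₃ % 3 = 1)
    (hk : (cellN b A₃).k = 1) : NFKummerHasUnit b A₃ 0 := by
  by_cases h9 : A₃ % 9 = 1
  · unfold cellN at hk
    simp only at hk
    split_ifs at hk with h1 h2 h3 h4 h5
    all_goals try simp_all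
    all_goals first
      | omega
      | exact nfKummerHasUnit_zero_of_cusp b A₃ (by omega) h9 h5
  · exact nfKummerHasUnit_zero_of_emod_nine b A₃ hA h9

/-- **The UNIT HALF (second conjunct) of T30.2/T30.3 + A1 `FlexNFCaseNKummerLawThree`, universally.** [folklore] -/
theorem flexNFCaseNKummerLawThree_unit_half :
    ∀ b A₃ : ℤ, A₃ % 3 = 1 → b ^ 3 ≠ A₃ → ((cellN b A₃).k = 1 → NFKummerHasUnit b A₃ 0) :=
  fun b A₃ hA _ hk ↦ nfKummerHasUnit_zero_of_cellN_k_eq_one b A₃ hA hk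

/-- The node reduced to its third conjunct: `FlexNFCaseNKummerLawThree` holds iff its `k = 0` (trivial-image)
clause holds on every Case-N cell. [folklore] -/
theorem flexNFCaseNKummerLawThree_iff_trivial_half :
    FlexNFCaseNKummerLawThree ↔
      ∀ b A₃ : ℤ, A₃ % 3 = 1 → b ^ 3 ≠ A₃ → ((cellN b A₃).k = 0 → NFKummerTrivial b A₃ 0) := by
  refine ⟨fun h b A₃ hA hne ↦ (h b A₃ hA hne).2.2, fun h b A₃ hA hne ↦ ⟨?_, ?_, h b A₃ hA hne⟩⟩
  · exact nfKummerFlat_zero b A₃ (by omega)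
  · exact flexNFCaseNKummerLawThree_unit_half b A₃ hA hne

end Summit.BirchSwinnertonDyer.Rank1Residual.O5.FlexNormalForm
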